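import Mathlib
import Summits.KontsevichZagierPeriods.Zeta5Search.EulerKernelBasisIntegrals
import Summits.KontsevichZagierPeriods.Zeta5Search.EulerKernelSquareIntegrals
import Summits.KontsevichZagierPeriods.Zeta5Search.EulerKernelTornheim
import Summits.KontsevichZagierPeriods.Zeta5Search.EulerKernelLogMoments
import HarnessLib

/-!
# The one-top datum `D2`, II: the last integration `∫₀¹ w(y)·M(y) dy = 2ζ(5) + 4ζ(2)ζ(3) − 5ζ(2) − 3/2`
# (cell `pub-zeta5`, seat ct-1 g21; item (3) of the wedge-dictionary programme; gen-1 g17 `LEVEL1-EXACT.md` Thm E)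

HONEST FRAMING: systematic search; no irrationality claim unless certified.  The value of ONE absolutely convergent
one-variable integral — the last (`y = t₂/t₄`) integration of the human evaluation of Brown–Zudilin's cellular integral at
the level-1 one-top point `(1,0,1,0,1,1,0,1)`:

  `∫₀¹ w(y) M(y) dy = 2ζ(5) + 4ζ(2)ζ(3) − 5ζ(2) − 3/2`,
  `w(y) = [y(π²/6 − Li₂(y)) + (1−y)log(1−y)]/(1−y)`  (the weight produced by the `t₁, t₅, t₃` integrations),
  `M(y) = −(1−2y)log(1−y)/y − (3−4y)(π²/6 + Li₂(y) + ½log²(1−y)) + 4 + 2log(1−y)`  (the `t₄`-kernel of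
  `WedgeDictionaryOneTopKernel`),

with integrability on `(0,1)` (`integral_wM`).  Proof: substitute `y = 1 − u`; by Euler's reflection `reDilog_reflection`,
`π²/6 − Li₂(1−u) = E(u) := Li₂(u) + log u·log(1−u)`, and `w(1−u)M(1−u)` is an explicit 18-term `ℚ[π²]`-combination of the
twelve basis integrands of `EulerKernelBasisIntegrals` / `EulerKernelSquareIntegrals` / `EulerKernelTornheim` (B1–B11) and
the logarithmic moments of `EulerKernelLogMoments` (pointwise identity: `field_simp; ring`); the `ζ(3)` and `ζ(4)`
contributions cancel and `2ζ(5)` comes from `½·B10 − B7 = 4ζ(5) − 2ζ(5)`.  Theorems only, no notation, no definition.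
Nothing here mentions the cellular integrals; `ζ(5)` is the value of a convergent integral — nothing about irrationality.
-/

noncomputable section

open MeasureTheory Set Filter Topology intervalIntegral

namespace Summit.KontsevichZagierPeriods.Zeta5Search.WedgeDictionaryOneTop

open Literature.Analysis.SpecialFunctions (reDilog reDilog_reflection)
open Literature.NumberTheory.Transcendental (zetaValue)
open Summit.KontsevichZagierPeriods.Zeta5Search.EulerKernel

/-- **The last integration**: `w·M` is integrable on `(0,1)` and `∫₀¹ w(y)M(y) dy = 2ζ(5) + 4ζ(2)ζ(3) − 5ζ(2) − 3/2`
(gen-1 g17 `LEVEL1-EXACT.md` Thm E: `D2 = J − 1 = θ − 5ζ₂ − 3/2`, `θ = 2ζ₅ + 4ζ₃ζ₂`). [folklore] -/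
theorem integral_wM :
    IntegrableOn (fun y : ℝ => (y * (Real.pi ^ 2 / 6 - reDilog y) + (1 - y) * Real.log (1 - y)) / (1 - y) *
      (-(1 - 2 * y) * Real.log (1 - y) / y - (3 - 4 * y) * (Real.pi ^ 2 / 6 + reDilog y + Real.log (1 - y) ^ 2 / 2)
        + 4 + 2 * Real.log (1 - y))) (Ioo 0 1) ∧
    ∫ y in Ioo (0:ℝ) 1, (fun y : ℝ => (y * (Real.pi ^ 2 / 6 - reDilog y) + (1 - y) * Real.log (1 - y)) / (1 - y) *
      (-(1 - 2 * y) * Real.log (1 - y) / y - (3 - 4 * y) * (Real.pi ^ 2 / 6 + reDilog y + Real.log (1 - y) ^ 2 / 2)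
        + 4 + 2 * Real.log (1 - y))) y
      = 2 * zetaValue 5 + 4 * zetaValue 2 * zetaValue 3 - 5 * zetaValue 2 - 3 / 2 := by
  -- the 18-term combination of basis pairs (coefficients in `ℚ[π²]`), built innermost-first
  have P18 := pair_smul (-1/2 : ℝ) (integral_pow_mul_negLog_pow 0 3)
  have P17 := pair_add (pair_smul (2 : ℝ) (integral_pow_mul_negLog_pow 1 3)) P18
  have P16 := pair_add (pair_smul (8 * (Real.pi ^ 2 / 6) : ℝ) (integral_pow_mul_negLog_pow 1 1)) P17
  have P15 := pair_add (pair_smul (-4 - 2 * (Real.pi ^ 2 / 6) : ℝ) (integral_pow_mul_negLog_pow 0 1)) P16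
  have P14 := pair_add (pair_smul (4 : ℝ) (integral_pow_mul_negLog_pow 0 2)) P15
  have P13 := pair_add (pair_smul (-1 : ℝ) integral_negLog_sq_div_one_sub) P14
  have P12 := pair_add (pair_smul (-4 : ℝ) integral_mul_Ek_sq) P13
  have P11 := pair_add (pair_smul (-1 : ℝ) integral_Ek_sq_div) P12
  have P10 := pair_add (pair_smul (5 : ℝ) integral_Ek_sq) P11
  have P9 := pair_add (pair_smul (2 : ℝ) integral_mul_negLog_sq_mul_Ek) P10
  have P8 := pair_add (pair_smul (1/2 : ℝ) integral_negLog_sq_mul_Ek_div) P9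
  have P7 := pair_add (pair_smul (-5/2 : ℝ) integral_negLog_sq_mul_Ek) P8
  have P6 := pair_add (pair_smul (8 * (Real.pi ^ 2 / 6) : ℝ) integral_mul_Ek) P7
  have P5 := pair_add (pair_smul (-4 - 10 * (Real.pi ^ 2 / 6) : ℝ) integral_Ek) P6
  have P4 := pair_add (pair_smul (4 + 2 * (Real.pi ^ 2 / 6) : ℝ) integral_Ek_div) P5
  have P3 := pair_add (pair_smul (-4 : ℝ) integral_mul_negLog_mul_Ek) P4
  have P2 := pair_add (pair_smul (5 : ℝ) integral_negLog_mul_Ek) P3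
  have P1 := pair_add (pair_smul (-3 : ℝ) integral_negLog_mul_Ek_div) P2
  -- pointwise: `w(1−u)·M(1−u)` IS that combination on `(0,1)`
  have Q := pair_congr measurableSet_Ioo P1 (g := fun u : ℝ => (fun y : ℝ => (y * (Real.pi ^ 2 / 6 - reDilog y) + (1 - y) * Real.log (1 - y)) / (1 - y) *
      (-(1 - 2 * y) * Real.log (1 - y) / y - (3 - 4 * y) * (Real.pi ^ 2 / 6 + reDilog y + Real.log (1 - y) ^ 2 / 2)
        + 4 + 2 * Real.log (1 - y))) (1 - u)) (by
    intro u hu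
    have hu0 : u ≠ 0 := hu.1.ne'
    have hu1 : 1 - u ≠ 0 := by linarith [hu.2]
    have hrefl : reDilog (1 - u) = Real.pi ^ 2 / 6 - Real.log u * Real.log (1 - u) - reDilog u := by
      rw [reDilog_reflection (x := 1 - u) (by linarith [hu.2]) (by linarith [hu.1]), sub_sub_cancel]; ring
    simp only [sub_sub_cancel, hrefl]
    generalize reDilog u = R
    generalize Real.log u = A
    generalize Real.log (1 - u) = B
    field_simp
    ring)
  -- back to the variable `y = 1 − u`
  have hI : IntegrableOn (fun y : ℝ => (y * (Real.pi ^ 2 / 6 - reDilog y) + (1 - y) * Real.log (1 - y)) / (1 - y) *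
      (-(1 - 2 * y) * Real.log (1 - y) / y - (3 - 4 * y) * (Real.pi ^ 2 / 6 + reDilog y + Real.log (1 - y) ^ 2 / 2)
        + 4 + 2 * Real.log (1 - y))) (Ioo 0 1) := by
    have h1 := (intervalIntegrable_iff_integrableOn_Ioo_of_le zero_le_one).2 Q.1
    have h2 := (h1.comp_sub_left 1).symm
    simp only [sub_sub_cancel, sub_self, sub_zero] at h2
    exact (intervalIntegrable_iff_integrableOn_Ioo_of_le zero_le_one).1 h2
  refine ⟨hI, ?_⟩
  have hcomp : ∫ y in Ioo (0:ℝ) 1, (fun y : ℝ => (y * (Real.pi ^ 2 / 6 - reDilog y) + (1 - y) * Real.log (1 - y)) / (1 - y) *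
      (-(1 - 2 * y) * Real.log (1 - y) / y - (3 - 4 * y) * (Real.pi ^ 2 / 6 + reDilog y + Real.log (1 - y) ^ 2 / 2)
        + 4 + 2 * Real.log (1 - y))) y
      = ∫ u in Ioo (0:ℝ) 1, (fun y : ℝ => (y * (Real.pi ^ 2 / 6 - reDilog y) + (1 - y) * Real.log (1 - y)) / (1 - y) *
      (-(1 - 2 * y) * Real.log (1 - y) / y - (3 - 4 * y) * (Real.pi ^ 2 / 6 + reDilog y + Real.log (1 - y) ^ 2 / 2)
        + 4 + 2 * Real.log (1 - y))) (1 - u) := by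
    rw [← integral_Ioc_eq_integral_Ioo, ← intervalIntegral.integral_of_le zero_le_one,
      ← integral_Ioc_eq_integral_Ioo, ← intervalIntegral.integral_of_le zero_le_one]
    have h := intervalIntegral.integral_comp_sub_left (fun y : ℝ => (y * (Real.pi ^ 2 / 6 - reDilog y) + (1 - y) * Real.log (1 - y)) / (1 - y) *
      (-(1 - 2 * y) * Real.log (1 - y) / y - (3 - 4 * y) * (Real.pi ^ 2 / 6 + reDilog y + Real.log (1 - y) ^ 2 / 2)
        + 4 + 2 * Real.log (1 - y))) (1:ℝ) (a := 0) (b := 1)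
    simp only [sub_self, sub_zero] at h
    exact h.symm
  rw [hcomp, Q.2, show zetaValue 2 = Real.pi ^ 2 / 6 from hasSum_zeta_two.tsum_eq]
  simp only [Nat.factorial, Nat.cast_ofNat, Nat.cast_zero, Nat.cast_succ]
  ring

end Summit.KontsevichZagierPeriods.Zeta5Search.WedgeDictionaryOneTop
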